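import Summits.ABC.ABC.Theorems.IsogenyGlueCongruenceEllipticGluingPrimeBoundSlicesOfBound
import Literature.AlgebraicGeometry.Motives.AbelianVarietyEndGaloisDescent
import Literature.NumberTheory.GaloisRepresentations.AbsGaloisGroup
import Literature.NumberTheory.EllipticCurves.ComplexMultiplicationHasCMIffHoldsProofs
import Literature.NumberTheory.DiophantineGeometry.FaltingsHeightJInvariantExplicit
import HarnessLib

/-!
# Crux U `EllipticGluingPrimeBound` (stmt-ABC-13919), line `SketchIdeator5` — the CM residual is a
# fully UNIFORM statement (skeleton v7, lead c6)

Line `SketchIdeator5` reduces the crux U to two residual statements, R_gen (non-CM curves) and R_cm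
(CM curves).  R_cm (`stub_cmCurvePartnerBound` of skeleton v1–v6) reads: there are absolute `κ ≥ 0`,
`C` such that for every CM curve `W/ℚ` with abelian-variety model `(E, e)`, every ℚ-simple partner
`A` geometrically free of `E`, and every prime `ℓ` of irreducible `W[ℓ]`, a `Γ_ℚ`-equivariant
embedding `W[ℓ] ↪ A(ℚ̄)` forces `ℓ ≤ C · ((dim A + 1) · max(1, h_F W))^κ`.

The factor `max(1, h_F W)` is spurious on the CM flank: the stable Faltings height is BOUNDED on CM
elliptic curves over `ℚ` (thirteen geometric isomorphism classes — the tree's theorem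
`j_mem_cmJInvariants_of_hasCM_holds` — and Silverman's explicit upper bound
`stableFaltingsHeight_le_explicit`, which give `h_F(W) ≤ 3`; that bound is the registered stub
`stub_cmHeightBound` of skeleton v7, PROVED here).  So R_cm is equivalent to the height-free,
fully uniform

  R_cm^unif: `ℓ ≤ C · (dim A + 1)^κ` for all such `(W, E, A, e, ℓ)` —

registered as `stub_cmUniformPartnerBound` (v7).  This file lands the registered stub
`stub_cmHeightBound` and the bookkeeping around the reshape:

* `stub_cmHeightBound` — **every CM elliptic curve over `ℚ` has `h_F ≤ 3`**: `j(W)` is one of the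
  thirteen integers of `cmJInvariants` (`j_mem_cmJInvariants_of_hasCM_holds`), so the denominator
  ideal of `j` is `⊤` and `|j| ≤ 262537412640768000 < e^{41}`, whence Silverman's explicit bound
  `stableFaltingsHeight_le_explicit` gives `h_F ≤ (0 + 41 − 9)/12 ≤ 3`;
* `cmCurvePartnerBound_of_uniform` — **R_cm^unif ⟹ R_cm** (the direction the landed composition
  `simpleFreeTorsionBound_of_slices` consumes; `max 1 h ≥ 1`, `κ ≥ 0`);
* `cmUniformPartnerBound_of_cmCurvePartnerBound_of_heightBound` — **(h_F ≤ 3 on CM curves) ⟹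
  R_cm ⟹ R_cm^unif** (constant `max C 0 · 3^κ`);
* `cmUniformPartnerBound_of_ellipticGluingPrimeBound_of_heightBound` — **(h_F ≤ 3 on CM curves) ⟹
  U ⟹ R_cm^unif**, through the landed necessity `cmCurvePartnerBound_of_ellipticGluingPrimeBound`
  (p126295); with `stub_cmHeightBound` this is the unconditional
  `cmUniformPartnerBound_of_ellipticGluingPrimeBound`: **U ⟹ R_cm^unif** — the reshaped stub is
  still crux-necessary — and `cmUniformPartnerBound_iff_cmCurvePartnerBound`: **R_cm^unif ⟺ R_cm**;
* `cmUniformSharing_of_cmUniformPartnerBound` — the `d = 1` SHADOW of R_cm^unif, now ABSOLUTE: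
  R_cm^unif ⟹ there is `L₀ : ℝ` such that for every CM curve `W/ℚ`, every elliptic `W'/ℚ` not
  geometrically isogenous to `W` (`Hom(E_ℚ̄, A_ℚ̄) = 0` for the models) and every prime `ℓ` of
  irreducible `W[ℓ]` with a `Γ_ℚ`-equivariant injection `W[ℓ] ↪ W'(ℚ̄)`: `ℓ ≤ L₀`.  Informally:
  congruences `W[ℓ] ≅ W'[ℓ]` between a CM and a geometrically non-isogenous elliptic curve over `ℚ`
  occur only at BOUNDED primes, uniformly in both curves.  For `ℓ` split in the CM field this is a
  theorem (image in a split Cartan normaliser: Bilu–Parent–Rebolledo 2013 and `ℓ = 13` by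
  Balakrishnan–Dogra–Müller–Tuitman–Vonk 2019, forcing `W'` to be CM, hence — sharing `W[ℓ]` — CM by
  the same field and geometrically isogenous to `W`); for `ℓ` inert it is a sub-case of the
  non-split-Cartan case of Serre's uniformity problem (open).  This pins the CM residual of the crux
  to a named uniform open problem with no height parameter at all.

Standard axioms; no definitions; no named facts; no `sorry`; lands `--supports stmt-ABC-13919`
(it proves the registered stub `stub_cmHeightBound` by name and signature).
-/

noncomputable section

-- `Summit.<Summit>.<Problem>` is the mandated summit-side namespace (CONVENTIONS §2); for the
-- single-conjunct summit `ABC` the two coincide, so the duplicate `ABC.ABC` is deliberate.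
set_option linter.dupNamespace false

namespace Summit.ABC.ABC.Theorems.GluingSlices

open CategoryTheory CategoryTheory.Limits AlgebraicGeometry
open Literature.AlgebraicGeometry.Motives
open Summit.ABC.ABC.Theses.IsogenyGlueCongruence
open Summit.ABC.ABC.Theorems.IsotypicMinkowski

/-! ### The CM height bound (registered stub `stub_cmHeightBound`) -/

/-- The thirteen rational CM `j`-invariants are integers of absolute value at most
`262537412640768000 = 640320³` (Silverman, *AEC* C.11 / *Advanced Topics* A §3, by inspection of
the tree's `WeierstrassCurve.cmJInvariants`). -/
theorem exists_int_of_mem_cmJInvariants {q : ℚ} (hq : q ∈ WeierstrassCurve.cmJInvariants) :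
    ∃ z : ℤ, (z : ℚ) = q ∧ |z| ≤ 262537412640768000 := by
  simp only [WeierstrassCurve.cmJInvariants, Finset.mem_insert, Finset.mem_singleton] at hq
  rcases hq with rfl | rfl | rfl | rfl | rfl | rfl | rfl | rfl | rfl | rfl | rfl | rfl | rfl
  · exact ⟨0, by norm_num, by norm_num⟩
  · exact ⟨1728, by norm_num, by norm_num⟩
  · exact ⟨-3375, by norm_num, by norm_num⟩
  · exact ⟨8000, by norm_num, by norm_num⟩
  · exact ⟨-32768, by norm_num, by norm_num⟩
  · exact ⟨54000, by norm_num, by norm_num⟩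
  · exact ⟨287496, by norm_num, by norm_num⟩
  · exact ⟨-884736, by norm_num, by norm_num⟩
  · exact ⟨-12288000, by norm_num, by norm_num⟩
  · exact ⟨16581375, by norm_num, by norm_num⟩
  · exact ⟨-884736000, by norm_num, by norm_num⟩
  · exact ⟨-147197952000, by norm_num, by norm_num⟩
  · exact ⟨-262537412640768000, by norm_num, by norm_num⟩

/-- `log 262537412640768000 ≤ 41` (`e > 2.718` and `2.718^{41} > 2.7 · 10^{17}`). -/
theorem log_cmJBound_le : Real.log (262537412640768000 : ℝ) ≤ 41 := by
  rw [Real.log_le_iff_le_exp (by norm_num)]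
  have h2 : (2.718 : ℝ) ≤ Real.exp 1 := by
    have := Real.exp_one_gt_d9; linarith
  have : Real.exp 41 = Real.exp 1 ^ 41 := by rw [← Real.exp_nat_mul]; norm_num
  rw [this]
  exact le_trans (by norm_num) (pow_le_pow_left₀ (by norm_num) h2 41)

/-- **STUB `stub_cmHeightBound` (skeleton v7 of line `SketchIdeator5`) — every elliptic curve over
`ℚ` with (geometric) complex multiplication has stable Faltings height `≤ 3`.**  By the tree's
theorem `j_mem_cmJInvariants_of_hasCM_holds` (Silverman *AEC* C.11 via the class number one
theorem) `j(W)` is one of thirteen integers of absolute value `≤ 262537412640768000`; so the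
denominator ideal `𝔇_j` is `⊤` (`one_mem_jDenominatorIdeal_iff`), `log N(𝔇_j) = 0`, the single
archimedean term is `log max(|j|, 1) ≤ 41` (`log_cmJBound_le`), and Silverman's explicit
`stableFaltingsHeight_le_explicit` gives `h_F(W) ≤ (41 − 9)/12 ≤ 3`. -/
theorem stub_cmHeightBound :
    ∀ (W : WeierstrassCurve ℚ) [W.IsElliptic], W.HasCM → W.stableFaltingsHeight ≤ 3 := by
  intro W _ hCM
  obtain ⟨z, hz, hzabs⟩ := exists_int_of_mem_cmJInvariants
    (Literature.NumberTheory.EllipticCurves.j_mem_cmJInvariants_of_hasCM_holds W hCM)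
  have h := Literature.NumberTheory.DiophantineGeometry.stableFaltingsHeight_le_explicit W
  -- the denominator ideal of an integral `j` is `⊤`
  have htop : W.jDenominatorIdeal = ⊤ := by
    rw [Ideal.eq_top_iff_one, WeierstrassCurve.one_mem_jDenominatorIdeal_iff]
    refine ⟨algebraMap ℤ (NumberField.RingOfIntegers ℚ) z, ?_⟩
    rw [NumberField.RingOfIntegers.coe_eq_algebraMap, ← IsScalarTower.algebraMap_apply,
      eq_intCast, hz]
  -- the single archimedean term
  have hterm : ∀ σ : ℚ →+* ℂ, Real.log (max ‖σ W.j‖ 1) ≤ 41 := by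
    intro σ
    refine le_trans (Real.log_le_log (by positivity) ?_) log_cmJBound_le
    rw [← hz, map_intCast, Complex.norm_intCast]
    refine max_le ?_ (by norm_num)
    exact_mod_cast hzabs
  have hsum : ∑ σ : ℚ →+* ℂ, Real.log (max ‖σ W.j‖ 1) ≤ 41 := by
    calc ∑ σ : ℚ →+* ℂ, Real.log (max ‖σ W.j‖ 1) ≤ ∑ _σ : ℚ →+* ℂ, (41 : ℝ) :=
          Finset.sum_le_sum fun σ _ => hterm σ
      _ = 41 := by
          rw [Finset.sum_const, Finset.card_univ, NumberField.Embeddings.card ℚ ℂ,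
            Module.finrank_self]
          simp
  have hfin : (Module.finrank ℚ ℚ : ℝ)⁻¹ = 1 := by simp
  rw [htop, Ideal.absNorm_top, Nat.cast_one, Real.log_one, hfin, mul_zero, one_mul, zero_add] at h
  linarith


/-- **R_cm^unif ⟹ R_cm.** The height-free uniform CM residual implies the `h`-form consumed by the
landed composition `simpleFreeTorsionBound_of_slices`: `(dim A + 1)^κ ≤ ((dim A + 1)·max(1,h))^κ`
because `max(1, h) ≥ 1` and `κ ≥ 0`; constant `max C 0`. -/
theorem cmCurvePartnerBound_of_uniform
    (h : ∃ κ C : ℝ, 0 ≤ κ ∧ ∀ (W : WeierstrassCurve ℚ) [W.IsElliptic] (E A : AbelianVariety.{0} ℚ)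
      (e : E.geomPoints ≃+ W.geomPoints),
      (∀ (σ : Field.absoluteGaloisGroup ℚ) (P : E.geomPoints), e (σ • P) = σ • e P) →
      (∀ f : E.baseChange (AlgebraicClosure ℚ) ⟶ A.baseChange (AlgebraicClosure ℚ), f = 0) →
      AbelianVariety.IsSimple A →
      ∀ ℓ : ℕ, ℓ.Prime → W.HasIrreducibleModPGaloisRep ℓ → W.HasCM →
      (∃ ι : W.geomTorsion ℓ →+ A.geomPoints, Function.Injective ι ∧
        ∀ (σ : Field.absoluteGaloisGroup ℚ) (P : W.geomTorsion ℓ), ι (σ • P) = σ • ι P) →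
        (ℓ : ℝ) ≤ C * ((A.dim : ℝ) + 1) ^ κ) :
    ∃ κ C : ℝ, 0 ≤ κ ∧ ∀ (W : WeierstrassCurve ℚ) [W.IsElliptic] (E A : AbelianVariety.{0} ℚ)
      (e : E.geomPoints ≃+ W.geomPoints),
      (∀ (σ : Field.absoluteGaloisGroup ℚ) (P : E.geomPoints), e (σ • P) = σ • e P) →
      (∀ f : E.baseChange (AlgebraicClosure ℚ) ⟶ A.baseChange (AlgebraicClosure ℚ), f = 0) →
      AbelianVariety.IsSimple A →
      ∀ ℓ : ℕ, ℓ.Prime → W.HasIrreducibleModPGaloisRep ℓ → W.HasCM →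
      (∃ ι : W.geomTorsion ℓ →+ A.geomPoints, Function.Injective ι ∧
        ∀ (σ : Field.absoluteGaloisGroup ℚ) (P : W.geomTorsion ℓ), ι (σ • P) = σ • ι P) →
        (ℓ : ℝ) ≤ C * (((A.dim : ℝ) + 1) * max 1 W.stableFaltingsHeight) ^ κ := by
  obtain ⟨κ, C, hκ, h⟩ := h
  refine ⟨κ, max C 0, hκ, ?_⟩
  intro W _ E A e he hfree hsimple ℓ hℓ hirr hCM hι
  have hb := h W E A e he hfree hsimple ℓ hℓ hirr hCM hι
  set m : ℝ := max 1 W.stableFaltingsHeight with hm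
  have hm1 : (1 : ℝ) ≤ m := le_max_left _ _
  have hd0 : (0 : ℝ) ≤ (A.dim : ℝ) + 1 := by positivity
  have hpow : ((A.dim : ℝ) + 1) ^ κ ≤ (((A.dim : ℝ) + 1) * m) ^ κ := by
    apply Real.rpow_le_rpow hd0 _ hκ
    calc (A.dim : ℝ) + 1 = ((A.dim : ℝ) + 1) * 1 := (mul_one _).symm
      _ ≤ ((A.dim : ℝ) + 1) * m := mul_le_mul_of_nonneg_left hm1 hd0
  calc (ℓ : ℝ) ≤ C * ((A.dim : ℝ) + 1) ^ κ := hb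
    _ ≤ max C 0 * ((A.dim : ℝ) + 1) ^ κ :=
        mul_le_mul_of_nonneg_right (le_max_left _ _) (Real.rpow_nonneg hd0 κ)
    _ ≤ max C 0 * (((A.dim : ℝ) + 1) * m) ^ κ :=
        mul_le_mul_of_nonneg_left hpow (le_max_right _ _)

/-- **(h_F ≤ 3 on CM curves) ⟹ R_cm ⟹ R_cm^unif.** Given the CM height bound (registered stub
`stub_cmHeightBound` of skeleton v7; here the hypothesis `hH`), the `h`-form CM residual implies the
height-free uniform one: `max(1, h_F W) ≤ 3`, so `((dim A + 1)·max(1,h))^κ ≤ 3^κ (dim A + 1)^κ`;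
constant `max C 0 · 3^κ`. -/
theorem cmUniformPartnerBound_of_cmCurvePartnerBound_of_heightBound
    (hH : ∀ (W : WeierstrassCurve ℚ) [W.IsElliptic], W.HasCM → W.stableFaltingsHeight ≤ 3)
    (h : ∃ κ C : ℝ, 0 ≤ κ ∧ ∀ (W : WeierstrassCurve ℚ) [W.IsElliptic] (E A : AbelianVariety.{0} ℚ)
      (e : E.geomPoints ≃+ W.geomPoints),
      (∀ (σ : Field.absoluteGaloisGroup ℚ) (P : E.geomPoints), e (σ • P) = σ • e P) →
      (∀ f : E.baseChange (AlgebraicClosure ℚ) ⟶ A.baseChange (AlgebraicClosure ℚ), f = 0) →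
      AbelianVariety.IsSimple A →
      ∀ ℓ : ℕ, ℓ.Prime → W.HasIrreducibleModPGaloisRep ℓ → W.HasCM →
      (∃ ι : W.geomTorsion ℓ →+ A.geomPoints, Function.Injective ι ∧
        ∀ (σ : Field.absoluteGaloisGroup ℚ) (P : W.geomTorsion ℓ), ι (σ • P) = σ • ι P) →
        (ℓ : ℝ) ≤ C * (((A.dim : ℝ) + 1) * max 1 W.stableFaltingsHeight) ^ κ) :
    ∃ κ C : ℝ, 0 ≤ κ ∧ ∀ (W : WeierstrassCurve ℚ) [W.IsElliptic] (E A : AbelianVariety.{0} ℚ)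
      (e : E.geomPoints ≃+ W.geomPoints),
      (∀ (σ : Field.absoluteGaloisGroup ℚ) (P : E.geomPoints), e (σ • P) = σ • e P) →
      (∀ f : E.baseChange (AlgebraicClosure ℚ) ⟶ A.baseChange (AlgebraicClosure ℚ), f = 0) →
      AbelianVariety.IsSimple A →
      ∀ ℓ : ℕ, ℓ.Prime → W.HasIrreducibleModPGaloisRep ℓ → W.HasCM →
      (∃ ι : W.geomTorsion ℓ →+ A.geomPoints, Function.Injective ι ∧
        ∀ (σ : Field.absoluteGaloisGroup ℚ) (P : W.geomTorsion ℓ), ι (σ • P) = σ • ι P) →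
        (ℓ : ℝ) ≤ C * ((A.dim : ℝ) + 1) ^ κ := by
  obtain ⟨κ, C, hκ, h⟩ := h
  refine ⟨κ, max C 0 * (3 : ℝ) ^ κ, hκ, ?_⟩
  intro W _ E A e he hfree hsimple ℓ hℓ hirr hCM hι
  have hb := h W E A e he hfree hsimple ℓ hℓ hirr hCM hι
  set m : ℝ := max 1 W.stableFaltingsHeight with hm
  have hm0 : (0 : ℝ) ≤ m := zero_le_one.trans (le_max_left _ _)
  have hm3 : m ≤ 3 := max_le (by norm_num) (hH W hCM)
  have hd0 : (0 : ℝ) ≤ (A.dim : ℝ) + 1 := by positivity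
  have hsplit : (((A.dim : ℝ) + 1) * m) ^ κ = ((A.dim : ℝ) + 1) ^ κ * m ^ κ :=
    Real.mul_rpow hd0 hm0
  have hmk : m ^ κ ≤ (3 : ℝ) ^ κ := Real.rpow_le_rpow hm0 hm3 hκ
  calc (ℓ : ℝ) ≤ C * (((A.dim : ℝ) + 1) * m) ^ κ := hb
    _ ≤ max C 0 * (((A.dim : ℝ) + 1) * m) ^ κ :=
        mul_le_mul_of_nonneg_right (le_max_left _ _) (Real.rpow_nonneg (by positivity) κ)
    _ = max C 0 * ((A.dim : ℝ) + 1) ^ κ * m ^ κ := by rw [hsplit, mul_assoc]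
    _ ≤ max C 0 * ((A.dim : ℝ) + 1) ^ κ * (3 : ℝ) ^ κ :=
        mul_le_mul_of_nonneg_left hmk (mul_nonneg (le_max_right _ _) (Real.rpow_nonneg hd0 κ))
    _ = max C 0 * (3 : ℝ) ^ κ * ((A.dim : ℝ) + 1) ^ κ := by ring

/-- **(h_F ≤ 3 on CM curves) ⟹ U ⟹ R_cm^unif** — the necessity certificate of the reshaped CM
residual of skeleton v7: the crux implies the `h`-form R_cm unconditionally
(`cmCurvePartnerBound_of_ellipticGluingPrimeBound`, p126295), and the CM height bound removes the
height.  So every proof of `EllipticGluingPrimeBound` proves the fully uniform CM torsion-sharing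
bound R_cm^unif. -/
theorem cmUniformPartnerBound_of_ellipticGluingPrimeBound_of_heightBound
    (hH : ∀ (W : WeierstrassCurve ℚ) [W.IsElliptic], W.HasCM → W.stableFaltingsHeight ≤ 3)
    (hU : EllipticGluingPrimeBound) :
    ∃ κ C : ℝ, 0 ≤ κ ∧ ∀ (W : WeierstrassCurve ℚ) [W.IsElliptic] (E A : AbelianVariety.{0} ℚ)
      (e : E.geomPoints ≃+ W.geomPoints),
      (∀ (σ : Field.absoluteGaloisGroup ℚ) (P : E.geomPoints), e (σ • P) = σ • e P) →
      (∀ f : E.baseChange (AlgebraicClosure ℚ) ⟶ A.baseChange (AlgebraicClosure ℚ), f = 0) →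
      AbelianVariety.IsSimple A →
      ∀ ℓ : ℕ, ℓ.Prime → W.HasIrreducibleModPGaloisRep ℓ → W.HasCM →
      (∃ ι : W.geomTorsion ℓ →+ A.geomPoints, Function.Injective ι ∧
        ∀ (σ : Field.absoluteGaloisGroup ℚ) (P : W.geomTorsion ℓ), ι (σ • P) = σ • ι P) →
        (ℓ : ℝ) ≤ C * ((A.dim : ℝ) + 1) ^ κ :=
  cmUniformPartnerBound_of_cmCurvePartnerBound_of_heightBound hH
    (cmCurvePartnerBound_of_ellipticGluingPrimeBound hU)

/-- **U ⟹ R_cm^unif, unconditionally** (necessity of the reshaped CM residual of skeleton v7):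
`cmUniformPartnerBound_of_ellipticGluingPrimeBound_of_heightBound` with the proved height stub
`stub_cmHeightBound`.  Every proof of the crux proves the fully uniform CM torsion-sharing bound. -/
theorem cmUniformPartnerBound_of_ellipticGluingPrimeBound (hU : EllipticGluingPrimeBound) :
    ∃ κ C : ℝ, 0 ≤ κ ∧ ∀ (W : WeierstrassCurve ℚ) [W.IsElliptic] (E A : AbelianVariety.{0} ℚ)
      (e : E.geomPoints ≃+ W.geomPoints),
      (∀ (σ : Field.absoluteGaloisGroup ℚ) (P : E.geomPoints), e (σ • P) = σ • e P) →
      (∀ f : E.baseChange (AlgebraicClosure ℚ) ⟶ A.baseChange (AlgebraicClosure ℚ), f = 0) →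
      AbelianVariety.IsSimple A →
      ∀ ℓ : ℕ, ℓ.Prime → W.HasIrreducibleModPGaloisRep ℓ → W.HasCM →
      (∃ ι : W.geomTorsion ℓ →+ A.geomPoints, Function.Injective ι ∧
        ∀ (σ : Field.absoluteGaloisGroup ℚ) (P : W.geomTorsion ℓ), ι (σ • P) = σ • ι P) →
        (ℓ : ℝ) ≤ C * ((A.dim : ℝ) + 1) ^ κ :=
  cmUniformPartnerBound_of_ellipticGluingPrimeBound_of_heightBound stub_cmHeightBound hU

/-- **R_cm^unif ⟺ R_cm, unconditionally**: the CM residual of line `SketchIdeator5` in its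
`h`-form (v1–v6) and in its height-free uniform form (v7) are equivalent statements. -/
theorem cmUniformPartnerBound_iff_cmCurvePartnerBound :
    (∃ κ C : ℝ, 0 ≤ κ ∧ ∀ (W : WeierstrassCurve ℚ) [W.IsElliptic] (E A : AbelianVariety.{0} ℚ)
      (e : E.geomPoints ≃+ W.geomPoints),
      (∀ (σ : Field.absoluteGaloisGroup ℚ) (P : E.geomPoints), e (σ • P) = σ • e P) →
      (∀ f : E.baseChange (AlgebraicClosure ℚ) ⟶ A.baseChange (AlgebraicClosure ℚ), f = 0) →
      AbelianVariety.IsSimple A →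
      ∀ ℓ : ℕ, ℓ.Prime → W.HasIrreducibleModPGaloisRep ℓ → W.HasCM →
      (∃ ι : W.geomTorsion ℓ →+ A.geomPoints, Function.Injective ι ∧
        ∀ (σ : Field.absoluteGaloisGroup ℚ) (P : W.geomTorsion ℓ), ι (σ • P) = σ • ι P) →
        (ℓ : ℝ) ≤ C * ((A.dim : ℝ) + 1) ^ κ) ↔
    (∃ κ C : ℝ, 0 ≤ κ ∧ ∀ (W : WeierstrassCurve ℚ) [W.IsElliptic] (E A : AbelianVariety.{0} ℚ)
      (e : E.geomPoints ≃+ W.geomPoints),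
      (∀ (σ : Field.absoluteGaloisGroup ℚ) (P : E.geomPoints), e (σ • P) = σ • e P) →
      (∀ f : E.baseChange (AlgebraicClosure ℚ) ⟶ A.baseChange (AlgebraicClosure ℚ), f = 0) →
      AbelianVariety.IsSimple A →
      ∀ ℓ : ℕ, ℓ.Prime → W.HasIrreducibleModPGaloisRep ℓ → W.HasCM →
      (∃ ι : W.geomTorsion ℓ →+ A.geomPoints, Function.Injective ι ∧
        ∀ (σ : Field.absoluteGaloisGroup ℚ) (P : W.geomTorsion ℓ), ι (σ • P) = σ • ι P) →
        (ℓ : ℝ) ≤ C * (((A.dim : ℝ) + 1) * max 1 W.stableFaltingsHeight) ^ κ) :=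
  ⟨cmCurvePartnerBound_of_uniform,
    cmUniformPartnerBound_of_cmCurvePartnerBound_of_heightBound stub_cmHeightBound⟩

/-- **The `d = 1` shadow of R_cm^unif is ABSOLUTE.** If R_cm^unif holds then there is a real
number `L₀` such that for all elliptic `W, W'/ℚ` with abelian-variety models `(E, e)`, `(A, e')`,
`Hom(E_ℚ̄, A_ℚ̄) = 0` (the curves are not geometrically isogenous), `W` with CM, and every prime `ℓ`
of irreducible `W[ℓ]` admitting a `Γ_ℚ`-equivariant injection `W[ℓ] ↪ W'(ℚ̄)`: `ℓ ≤ L₀`.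
Congruences between CM and geometrically non-isogenous elliptic curves over `ℚ` occur only at
bounded primes — uniformly in BOTH curves (split primes: Bilu–Parent–Rebolledo; inert primes: the
non-split-Cartan case of Serre's uniformity problem).  Proof: specialise R_cm^unif to the model `A`
of `W'` (`dim A = 1`, so `A` is ℚ-simple, `AbelianVariety.isSimple_of_dim_le_one`), transporting
the injection along `e'⁻¹`; the bound is `C · 2^κ =: L₀`. -/
theorem cmUniformSharing_of_cmUniformPartnerBound
    (h : ∃ κ C : ℝ, 0 ≤ κ ∧ ∀ (W : WeierstrassCurve ℚ) [W.IsElliptic] (E A : AbelianVariety.{0} ℚ)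
      (e : E.geomPoints ≃+ W.geomPoints),
      (∀ (σ : Field.absoluteGaloisGroup ℚ) (P : E.geomPoints), e (σ • P) = σ • e P) →
      (∀ f : E.baseChange (AlgebraicClosure ℚ) ⟶ A.baseChange (AlgebraicClosure ℚ), f = 0) →
      AbelianVariety.IsSimple A →
      ∀ ℓ : ℕ, ℓ.Prime → W.HasIrreducibleModPGaloisRep ℓ → W.HasCM →
      (∃ ι : W.geomTorsion ℓ →+ A.geomPoints, Function.Injective ι ∧
        ∀ (σ : Field.absoluteGaloisGroup ℚ) (P : W.geomTorsion ℓ), ι (σ • P) = σ • ι P) →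
        (ℓ : ℝ) ≤ C * ((A.dim : ℝ) + 1) ^ κ) :
    ∃ L₀ : ℝ, ∀ (W W' : WeierstrassCurve ℚ) [W.IsElliptic] [W'.IsElliptic]
      (E A : AbelianVariety.{0} ℚ) (e : E.geomPoints ≃+ W.geomPoints)
      (e' : A.geomPoints ≃+ W'.geomPoints),
      (∀ (σ : Field.absoluteGaloisGroup ℚ) (P : E.geomPoints), e (σ • P) = σ • e P) →
      (∀ (σ : Field.absoluteGaloisGroup ℚ) (P : A.geomPoints), e' (σ • P) = σ • e' P) →
      (∀ f : E.baseChange (AlgebraicClosure ℚ) ⟶ A.baseChange (AlgebraicClosure ℚ), f = 0) →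
      W.HasCM → ∀ ℓ : ℕ, ℓ.Prime → W.HasIrreducibleModPGaloisRep ℓ →
      (∃ ι : W.geomTorsion ℓ →+ W'.geomPoints, Function.Injective ι ∧
        ∀ (σ : Field.absoluteGaloisGroup ℚ) (P : W.geomTorsion ℓ), ι (σ • P) = σ • ι P) →
        (ℓ : ℝ) ≤ L₀ := by
  obtain ⟨κ, C, hκ, h⟩ := h
  refine ⟨C * (2 : ℝ) ^ κ, ?_⟩
  intro W W' _ _ E A e e' he he' hfree hCM ℓ hℓ hirr hι
  obtain ⟨ι, hinj, hιeq⟩ := hι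
  -- transport the embedding along `e'⁻¹ : W'(ℚ̄) ≃ A(ℚ̄)`
  have he'symm : ∀ (σ : Field.absoluteGaloisGroup ℚ) (Q : W'.geomPoints),
      e'.symm (σ • Q) = σ • e'.symm Q := by
    intro σ Q
    apply e'.injective
    rw [he', e'.apply_symm_apply, e'.apply_symm_apply]
  let ι' : W.geomTorsion ℓ →+ A.geomPoints := (e'.symm : W'.geomPoints →+ A.geomPoints).comp ι
  have hι' : ∃ ι' : W.geomTorsion ℓ →+ A.geomPoints, Function.Injective ι' ∧
      ∀ (σ : Field.absoluteGaloisGroup ℚ) (P : W.geomTorsion ℓ), ι' (σ • P) = σ • ι' P := by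
    refine ⟨ι', e'.symm.injective.comp hinj, fun σ P ↦ ?_⟩
    show e'.symm (ι (σ • P)) = σ • e'.symm (ι P)
    rw [hιeq, he'symm]
  -- `dim A = 1`, so `A` is ℚ-simple
  have hA1 : A.dim = 1 := dim_eq_one_of_equiv e'
  have hsimple : AbelianVariety.IsSimple A := AbelianVariety.isSimple_of_dim_le_one hA1.le
  have hbound := h W E A e he hfree hsimple ℓ hℓ hirr hCM hι'
  have hdim : ((A.dim : ℝ) + 1) = 2 := by rw [hA1]; norm_num
  rw [hdim] at hbound
  exact hbound

end Summit.ABC.ABC.Theorems.GluingSlices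

end
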